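import Literature.NumberTheory.Automorphic.DiscreteAutomorphicRepArchModuleCM
import Literature.RepresentationTheory.BorelWallach2000.TrivialModuleGKCohomologyUnitary
import Summits.HodgeConjecture.HodgeConjecture.Theorems.F0P2aL2cOrderedProducts
import HarnessLib

/-!
# FLOOR-0 P3 — rung-1 support: the CM FRAME BRIDGE `U(2,1)_{Fin 2 ⊕ Fin 1} ≅ U21` for orbits, one-parameter groups and
# the maximal compact subgroup (exp ∘ reindex = reindex ∘ exp; `K` goes to the block-diagonal stabiliser of `x₀`)

Cell hodgecm-mathlib, FLOOR 0, crux item H413 = stmt-HodgeConjecture-24833; brief B1′ of the P3 integrator («the value-map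
adapter», F0P3-plan (g0) 2026-08-31T00:17:32Z), author F0P3-p01 (g3).  PROOF lane (no `def`, no instance, no named fact).

The archimedean `(𝔤, K)`-module of a discrete automorphic representation of the CM unitary group `U(H)` is typed (★
`DiscreteAutomorphicRepArchModuleCM`, D4 companion) for the linear real group `G = uFormGroup (Fin 2) (Fin 1)` along
`ιG = cmArchSectionUForm L ι H T hT = cmArchSection ∘ u21FrameEquivFin1⁻¹`, whereas the analysis of holomorphic cotangent forms
(★ `UnitaryGroupCohomologicalForms`, ★ `F0P2aL2bHolLieSpanPackage`, ★ `U21AnalyticVectors`) is carried out along the ball-model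
section `cmArchSection : U21 →* U(H)(𝔸_{L⁺})` for `u21Group : RealMatrixGroup ℂ (Fin 3)`.  This file is the dictionary
between the two frames, along the reindexing `e = finSumFinEquiv : Fin 2 ⊕ Fin 1 ≃ Fin 3` (which IS the inverse of ★
`frameIdxFin1`, `frameIdxFin1_symm_eq`):

* §1 `exp_reindex` (the matrix exponential commutes with reindexing), `mat_u21FrameEquivFin1_symm`
  (`mat (u21FrameEquivFin1⁻¹ h) = reindex e e h`), and **`cmArchSectionUForm_expMem_smul`**: for `Y ∈ 𝔲(2,1)_{Fin 2 ⊕ Fin 1}` and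
  its reindexed copy `Y♭ ∈ 𝔲(2,1)_{Fin 3}` (`(Y♭ : M₃(ℂ)) = reindex e e Y`),
  `cmArchSectionUForm (exp (tY)) = cmArchSection (exp (tY♭))` — the one-parameter groups of the two frames MATCH;
  `exists_reindexed` supplies `Y♭`, and `reindexed_upqUnit` says `(X_{cE_{a,0}})♭ = X_{Pi.single a c}` (★ `liePMat`).
* §2 the maximal compact subgroup under the frame: for `k ∈ K = U(2,1) ∩ U(3)` (block diagonal with unitary blocks, ★
  `upq_K_blocks`) there is `κ = (k₁₁, k₂₂) ∈ U(2) × U(1)` with `u21FrameEquivFin1⁻¹ k = blockU κ` (★ `UnitBallIsotropyBlock`), so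
  `cmArchSectionUForm k = cmArchSection (blockU κ)` and, for a holomorphic cotangent form `Φ`, the `K`-TYPE READS
  `Φ (x · cmArchSectionUForm k) j = ∑ i conj(k₂₂) k₁₁ᵢⱼ Φ(x) i` (★ `weightForms` of the cotangent weight, ★ `Jac_blockU_x₀`:
  `Jac (diag(A, d)) x₀ = d̄ A`);
* §3 matrix-entry bookkeeping in `𝔲(2,1)_{Fin 2 ⊕ Fin 1}` for the value map `φ(Y) = ∑ⱼ Y_{(inl j)(inr 0)} • vⱼ`:
  the `𝔭`-entries of `Ad(k) Y` (`Ad_K_apply_inl_inr`), of `⁅z₀, Y⁆` (`lie_upqZ0_apply_inl_inr`: multiplication by `i`), of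
  `W ∈ 𝔨` (zero) and of the frame `X_{cE_{a,0}}`.

References: Borel–Jacquet 1979 §4.1 (archimedean components) [BorelJacquetCorvallis1979]; Borel–Wallach 2000, II §4.1, VI 4.7–4.8
[BorelWallach2000]; Konno–Konno 2007 §3.1 (frames of `U(p,q)`) [KonnoKonno2007]; Knapp 2002, I §1 Example (3), I §10 [Knapp2002].
HONEST LABEL: HC_CM is proved only modulo the printed citations until rung 0 closes; this file discharges none of them.
-/

-- Mathlib idiom (Mathlib/Algebra/Lie/OfAssociative.lean; as in ★ `GKModules` and every `(𝔤, K)` file of the tree):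
-- the commutator bracket on matrices, needed to MENTION the Lie algebras `(uFormGroup _ _).lie`, `u21Group.lie`.
attribute [local instance 100] LieRing.ofAssociativeRing

-- The scoped `L^∞`-operator normed structure on matrices agrees with the product topology only up to non-reducible
-- unfolding (cf. `Matrix.exp_add_of_commute` in Mathlib and ★ `GKModulesSmoothVectorsProofs`).
set_option backward.isDefEq.respectTransparency false

set_option autoImplicit false
set_option linter.dupNamespace false

noncomputable section

open scoped Matrix MatrixGroups ComplexConjugate
open NumberField MeasureTheory MulAction

namespace Summit.HodgeConjecture.HodgeConjecture.Cruxes.H413.F0P3CMFrameOrbit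

open Literature.NumberTheory.Automorphic Literature.NumberTheory.Automorphic.UnitaryGroup
open Literature.NumberTheory.Automorphic.UnitaryGroup.CotangentForms
open Literature.NumberTheory.Automorphic.U21 (K21 matA sclD)
open Literature.RepresentationTheory.KonnoKonno2007 Literature.RepresentationTheory.KonnoKonno2007.RealDualPair
open Literature.RepresentationTheory.BorelWallach2000
open Literature.Geometry.ComplexHyperbolic.BallModel (U21 mat x₀ blockU blockK coe_blockK mat_blockU bmat Jac Jac_blockU_x₀ J)
open Literature.AlgebraicGeometry.ShimuraVarieties.BallForms (u21Group liePMat pMat coe_liePMat cotangentCocycle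
  cotangentCocycle_apply isPullbackCocycle_cotangentCocycle u21Group_lie)
open Summit.HodgeConjecture.HodgeConjecture.Cruxes.H413.F0P2aL2cOrderedProducts

/-! ## §1 Exponentials and one-parameter groups under the frame -/

section Exp

open scoped Matrix.Norms.Operator in
/-- **The matrix exponential commutes with reindexing**: `exp (reindex e e M) = reindex e e (exp M)` (reindexing is a
continuous algebra isomorphism). [cite: Knapp2002, I §10] -/
theorem exp_reindex {m n : Type*} [Fintype m] [DecidableEq m] [Fintype n] [DecidableEq n] (e : m ≃ n)
    (M : Matrix m m ℂ) :
    NormedSpace.exp (Matrix.reindex e e M) = Matrix.reindex e e (NormedSpace.exp M) := by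
  have hc : Continuous (Matrix.reindexAlgEquiv ℂ ℂ e : Matrix m m ℂ → Matrix n n ℂ) := by
    rw [Matrix.coe_reindexAlgEquiv]
    exact LinearMap.continuous_of_finiteDimensional
      ((Matrix.reindexLinearEquiv ℝ ℂ e e : Matrix m m ℂ ≃ₗ[ℝ] Matrix n n ℂ) : Matrix m m ℂ →ₗ[ℝ] Matrix n n ℂ)
  have h := NormedSpace.map_exp (Matrix.reindexAlgEquiv ℂ ℂ e) hc M
  rw [Matrix.coe_reindexAlgEquiv] at h
  exact h.symm

/-- `frameIdxFin1⁻¹ = finSumFinEquiv`: the frame of ★ `DiscreteAutomorphicRepArchModuleCM` is the reindexing used by ★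
`F0P2aL2cOrderedProducts` (`0,1 ↦ inl 0, inl 1`, `2 ↦ inr 0`). [cite: KonnoKonno2007, §3.1] -/
theorem frameIdxFin1_symm_eq : frameIdxFin1.symm = (finSumFinEquiv : Fin 2 ⊕ Fin 1 ≃ Fin 3) := by
  ext x
  rcases x with i | i <;> fin_cases i <;> rfl

/-- `frameIdxFin1 = finSumFinEquiv⁻¹`. [cite: KonnoKonno2007, §3.1] -/
theorem frameIdxFin1_eq : frameIdxFin1 = (finSumFinEquiv : Fin 2 ⊕ Fin 1 ≃ Fin 3).symm := by
  rw [← frameIdxFin1_symm_eq, Equiv.symm_symm]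

/-- **The matrix of `u21FrameEquivFin1⁻¹ h` is `reindex e e h`**, `e = finSumFinEquiv`. [cite: KonnoKonno2007, §3.1] -/
theorem mat_u21FrameEquivFin1_symm (h : UForm (Fin 2) (Fin 1)) :
    mat (u21FrameEquivFin1.symm h) =
      Matrix.reindex (finSumFinEquiv : Fin 2 ⊕ Fin 1 ≃ Fin 3) (finSumFinEquiv : Fin 2 ⊕ Fin 1 ≃ Fin 3)
        ((h : GL (Fin 2 ⊕ Fin 1) ℂ) : Matrix (Fin 2 ⊕ Fin 1) (Fin 2 ⊕ Fin 1) ℂ) := by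
  have e := coe_u21FrameEquivFin1 (u21FrameEquivFin1.symm h)
  rw [ContinuousMulEquiv.apply_symm_apply] at e
  have e' := congrArg (Matrix.reindex frameIdxFin1.symm frameIdxFin1.symm) e
  rw [← Matrix.reindex_symm, Equiv.symm_apply_apply] at e'
  rw [← e', Matrix.reindex_symm, frameIdxFin1_symm_eq]

/-- Every `Y ∈ 𝔲(2,1)_{Fin 2 ⊕ Fin 1}` has a reindexed copy `Y♭ ∈ 𝔲(2,1)_{Fin 3}` (★ `reindex_mem_u21Lie`). [cite: Knapp2002, I §1 Example (3)] -/
theorem exists_reindexed (Y : (uFormGroup (Fin 2) (Fin 1)).lie) :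
    ∃ Y' : u21Group.lie, (Y' : Matrix (Fin 3) (Fin 3) ℂ) =
      Matrix.reindex (finSumFinEquiv : Fin 2 ⊕ Fin 1 ≃ Fin 3) (finSumFinEquiv : Fin 2 ⊕ Fin 1 ≃ Fin 3)
        (Y : Matrix (Fin 2 ⊕ Fin 1) (Fin 2 ⊕ Fin 1) ℂ) :=
  ⟨⟨_, reindex_mem_u21Lie Y.2⟩, rfl⟩

/-- The reindexed copy is additive. [folklore] -/
theorem reindexed_add {Y₁ Y₂ : (uFormGroup (Fin 2) (Fin 1)).lie} {Y₁' Y₂' : u21Group.lie}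
    (h₁ : (Y₁' : Matrix (Fin 3) (Fin 3) ℂ) = Matrix.reindex (finSumFinEquiv : Fin 2 ⊕ Fin 1 ≃ Fin 3) finSumFinEquiv
      (Y₁ : Matrix (Fin 2 ⊕ Fin 1) (Fin 2 ⊕ Fin 1) ℂ))
    (h₂ : (Y₂' : Matrix (Fin 3) (Fin 3) ℂ) = Matrix.reindex (finSumFinEquiv : Fin 2 ⊕ Fin 1 ≃ Fin 3) finSumFinEquiv
      (Y₂ : Matrix (Fin 2 ⊕ Fin 1) (Fin 2 ⊕ Fin 1) ℂ)) :
    ((Y₁' + Y₂' : u21Group.lie) : Matrix (Fin 3) (Fin 3) ℂ) =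
      Matrix.reindex (finSumFinEquiv : Fin 2 ⊕ Fin 1 ≃ Fin 3) finSumFinEquiv
        ((Y₁ + Y₂ : (uFormGroup (Fin 2) (Fin 1)).lie) : Matrix (Fin 2 ⊕ Fin 1) (Fin 2 ⊕ Fin 1) ℂ) := by
  change (Y₁' : Matrix (Fin 3) (Fin 3) ℂ) + (Y₂' : Matrix (Fin 3) (Fin 3) ℂ) =
    Matrix.reindex finSumFinEquiv finSumFinEquiv
      ((Y₁ : Matrix (Fin 2 ⊕ Fin 1) (Fin 2 ⊕ Fin 1) ℂ) + (Y₂ : Matrix (Fin 2 ⊕ Fin 1) (Fin 2 ⊕ Fin 1) ℂ))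
  rw [h₁, h₂]
  ext i j
  simp [Matrix.reindex_apply, Matrix.submatrix_apply]

/-- The reindexed copy is real-homogeneous. [folklore] -/
theorem reindexed_smul {Y : (uFormGroup (Fin 2) (Fin 1)).lie} {Y' : u21Group.lie}
    (h : (Y' : Matrix (Fin 3) (Fin 3) ℂ) = Matrix.reindex (finSumFinEquiv : Fin 2 ⊕ Fin 1 ≃ Fin 3) finSumFinEquiv
      (Y : Matrix (Fin 2 ⊕ Fin 1) (Fin 2 ⊕ Fin 1) ℂ)) (t : ℝ) :
    ((t • Y' : u21Group.lie) : Matrix (Fin 3) (Fin 3) ℂ) =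
      Matrix.reindex (finSumFinEquiv : Fin 2 ⊕ Fin 1 ≃ Fin 3) finSumFinEquiv
        ((t • Y : (uFormGroup (Fin 2) (Fin 1)).lie) : Matrix (Fin 2 ⊕ Fin 1) (Fin 2 ⊕ Fin 1) ℂ) := by
  change t • (Y' : Matrix (Fin 3) (Fin 3) ℂ) =
    Matrix.reindex finSumFinEquiv finSumFinEquiv (t • (Y : Matrix (Fin 2 ⊕ Fin 1) (Fin 2 ⊕ Fin 1) ℂ))
  rw [h]
  ext i j
  simp [Matrix.reindex_apply, Matrix.submatrix_apply]

/-- **The frame of the engine is the frame of ★ `F0P2aL2cOrderedProducts`**: `(X_{cE_{a,0}})♭ = X_{Pi.single a c}`, i.e. the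
reindexed copy of `upqUnit (a, 0) c` is ★ `liePMat (Pi.single a c)` (★ `reindex_upqUnit`). [cite: BorelWallach2000, VI 4.8 (3)] -/
theorem reindexed_upqUnit (p : Fin 2 × Fin 1) (c : ℂ) :
    ((liePMat (Pi.single p.1 c) : u21Group.lie) : Matrix (Fin 3) (Fin 3) ℂ) =
      Matrix.reindex (finSumFinEquiv : Fin 2 ⊕ Fin 1 ≃ Fin 3) finSumFinEquiv
        ((upqUnit p c : (uFormGroup (Fin 2) (Fin 1)).lie) : Matrix (Fin 2 ⊕ Fin 1) (Fin 2 ⊕ Fin 1) ℂ) := by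
  rw [prod_fin_one_eq p, coe_liePMat, reindex_upqUnit]

variable (L : Type) [Field L] [NumberField L] [IsCMField L] (ι : L →+* ℂ) (H : Matrix (Fin 3) (Fin 3) L)
  (T : GL (Fin 3) ℂ) (hT : (T : Matrix (Fin 3) (Fin 3) ℂ)ᴴ * H.map ι * (T : Matrix (Fin 3) (Fin 3) ℂ) = J)

/-- **The one-parameter groups of the two frames match**: `u21FrameEquivFin1⁻¹ (exp (tY)) = exp (tY♭)` in `U21`, for
`Y ∈ 𝔲(2,1)_{Fin 2 ⊕ Fin 1}` with reindexed copy `Y♭` (`exp ∘ reindex = reindex ∘ exp`). [cite: Knapp2002, I §10] -/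
theorem u21FrameEquivFin1_symm_expMem_smul (Y : (uFormGroup (Fin 2) (Fin 1)).lie) (Y' : u21Group.lie)
    (hY : (Y' : Matrix (Fin 3) (Fin 3) ℂ) = Matrix.reindex (finSumFinEquiv : Fin 2 ⊕ Fin 1 ≃ Fin 3) finSumFinEquiv
      (Y : Matrix (Fin 2 ⊕ Fin 1) (Fin 2 ⊕ Fin 1) ℂ)) (t : ℝ) :
    u21FrameEquivFin1.symm ((uFormGroup (Fin 2) (Fin 1)).expMem (t • Y)) = u21Group.expMem (t • Y') := by
  apply Subtype.ext
  apply Units.ext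
  change mat (u21FrameEquivFin1.symm ((uFormGroup (Fin 2) (Fin 1)).expMem (t • Y))) =
    (((u21Group.expMem (t • Y') : u21Group.carrier) : GL (Fin 3) ℂ) : Matrix (Fin 3) (Fin 3) ℂ)
  rw [mat_u21FrameEquivFin1_symm, RealMatrixGroup.coe_expMem, coe_expGL, RealMatrixGroup.coe_expMem, coe_expGL,
    reindexed_smul hY t, exp_reindex]

/-- **`cmArchSectionUForm (exp (tY)) = cmArchSection (exp (tY♭))`**: the CM section of the `Fin 2 ⊕ Fin 1` frame on a
one-parameter group of `𝔲(2,1)_{Fin 2 ⊕ Fin 1}` is the ball-model CM section on the reindexed one-parameter group — the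
orbit maps `t ↦ R(cmArchSectionUForm (exp tY)) v` of ★ `P.archRepCM` are the orbit maps of the analytic files.
[cite: BorelJacquetCorvallis1979, §4.1] -/
theorem cmArchSectionUForm_expMem_smul (Y : (uFormGroup (Fin 2) (Fin 1)).lie) (Y' : u21Group.lie)
    (hY : (Y' : Matrix (Fin 3) (Fin 3) ℂ) = Matrix.reindex (finSumFinEquiv : Fin 2 ⊕ Fin 1 ≃ Fin 3) finSumFinEquiv
      (Y : Matrix (Fin 2 ⊕ Fin 1) (Fin 2 ⊕ Fin 1) ℂ)) (t : ℝ) :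
    cmArchSectionUForm L ι H T hT ((uFormGroup (Fin 2) (Fin 1)).expMem (t • Y)) =
      cmArchSection L ι H T hT (u21Group.expMem (t • Y')) := by
  rw [cmArchSectionUForm_apply, u21FrameEquivFin1_symm_expMem_smul Y Y' hY t]

end Exp

/-! ## §2 The maximal compact subgroup under the frame; the `K`-type of holomorphic cotangent forms -/

section Compact

/-- **`K = U(2,1)_{Fin 2 ⊕ Fin 1} ∩ U(3)` goes to the block-diagonal stabiliser of `x₀`**: for `k ∈ K` there is
`κ = (k₁₁, k₂₂) ∈ U(2) × U(1)` with `u21FrameEquivFin1⁻¹ k = blockU κ`, `matA κ = k₁₁`, `sclD κ = k₂₂`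
(★ `upq_K_blocks`: `k` is block diagonal with unitary blocks). [cite: BorelWallach2000, VI 4.7] [cite: KonnoKonno2007, §3.1] -/
theorem exists_blockU_eq (k : (uFormGroup (Fin 2) (Fin 1)).maximalCompact) :
    ∃ κ : K21,
      u21FrameEquivFin1.symm
          (Subgroup.inclusion (uFormGroup (Fin 2) (Fin 1)).maximalCompact_le_carrier k :
            (uFormGroup (Fin 2) (Fin 1)).carrier) = blockU κ ∧
      matA κ = ((k : GL (Fin 2 ⊕ Fin 1) ℂ) : Matrix (Fin 2 ⊕ Fin 1) (Fin 2 ⊕ Fin 1) ℂ).toBlocks₁₁ ∧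
      sclD κ = ((k : GL (Fin 2 ⊕ Fin 1) ℂ) : Matrix (Fin 2 ⊕ Fin 1) (Fin 2 ⊕ Fin 1) ℂ) (Sum.inr 0) (Sum.inr 0) := by
  obtain ⟨h12, h21, h11a, h11b, h22a, h22b⟩ := upq_K_blocks k
  set kM : Matrix (Fin 2 ⊕ Fin 1) (Fin 2 ⊕ Fin 1) ℂ := ((k : GL (Fin 2 ⊕ Fin 1) ℂ) : Matrix (Fin 2 ⊕ Fin 1) (Fin 2 ⊕ Fin 1) ℂ) with hkM
  have hA : kM.toBlocks₁₁ ∈ Matrix.unitaryGroup (Fin 2) ℂ := by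
    rw [Matrix.mem_unitaryGroup_iff, Matrix.star_eq_conjTranspose]
    exact h11b
  have hd1 : (starRingEnd ℂ) (kM (Sum.inr 0) (Sum.inr 0)) * kM (Sum.inr 0) (Sum.inr 0) = 1 := by
    have e := congrFun (congrFun h22a 0) 0
    simpa [Matrix.mul_apply, Matrix.toBlocks₂₂, Matrix.conjTranspose_apply] using e
  have hd2 : kM (Sum.inr 0) (Sum.inr 0) * (starRingEnd ℂ) (kM (Sum.inr 0) (Sum.inr 0)) = 1 := by
    rw [mul_comm]; exact hd1
  have hd : kM (Sum.inr 0) (Sum.inr 0) ∈ unitary ℂ := Unitary.mem_iff.2 ⟨hd1, hd2⟩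
  refine ⟨(⟨kM.toBlocks₁₁, hA⟩, ⟨kM (Sum.inr 0) (Sum.inr 0), hd⟩), ?_, rfl, rfl⟩
  apply Subtype.ext
  apply Units.ext
  change mat (u21FrameEquivFin1.symm _) = mat (blockU _)
  rw [mat_u21FrameEquivFin1_symm, mat_blockU]
  change Matrix.reindex finSumFinEquiv finSumFinEquiv kM = bmat kM.toBlocks₁₁ (kM (Sum.inr 0) (Sum.inr 0))
  have hk12 : ∀ (i : Fin 2) (j : Fin 1), kM (Sum.inl i) (Sum.inr j) = 0 := fun i j => congrFun (congrFun h12 i) j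
  have hk21 : ∀ (i : Fin 1) (j : Fin 2), kM (Sum.inr i) (Sum.inl j) = 0 := fun i j => congrFun (congrFun h21 i) j
  ext i j
  fin_cases i <;> fin_cases j <;>
    simp [bmat, Matrix.reindex_apply, Matrix.submatrix_apply, finSumFinEquiv_symm_zero, finSumFinEquiv_symm_one,
      finSumFinEquiv_symm_two, Matrix.toBlocks₁₁, hk12, hk21]

variable (L : Type) [Field L] [NumberField L] [IsCMField L] (ι : L →+* ℂ) (H : Matrix (Fin 3) (Fin 3) L)
  (T : GL (Fin 3) ℂ) (hT : (T : Matrix (Fin 3) (Fin 3) ℂ)ᴴ * H.map ι * (T : Matrix (Fin 3) (Fin 3) ℂ) = J)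

/-- **The `K`-type of a holomorphic cotangent form, read in the `Fin 2 ⊕ Fin 1` frame**: for
`Φ ∈ holCotForms` of the CM frame and `k ∈ K`, `Φ (x · cmArchSectionUForm k) j = ∑ i conj(k₂₂) (k₁₁)ᵢⱼ Φ(x) i` — the
cotangent weight `Φ(x · ι_∞ u) = (Jac u x₀)ᵀ Φ(x)` of ★ `weightForms` at `u = blockU (k₁₁, k₂₂)`, where
`Jac (diag(A, d)) x₀ = d̄ A` (★ `Jac_blockU_x₀`). [cite: BorelWallach2000, VI 4.8] [cite: Borel1997, §5.14] -/
theorem apply_mul_cmArchSectionUForm_K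
    {Φ : (adelicGroupData (↥(maximalRealSubfield L)) L (IsCMField.complexConj L) 3 H).Adelic → (Fin 2 → ℂ)}
    (hΦ : Φ ∈ holCotForms (↥(maximalRealSubfield L)) L (IsCMField.complexConj L) 3 H (cmArchSection L ι H T hT)
      (cmCompactFactor L ι H T hT))
    (k : (uFormGroup (Fin 2) (Fin 1)).maximalCompact)
    (x : (adelicGroupData (↥(maximalRealSubfield L)) L (IsCMField.complexConj L) 3 H).Adelic) (j : Fin 2) :
    Φ (x * cmArchSectionUForm L ι H T hT (Subgroup.inclusion (uFormGroup (Fin 2) (Fin 1)).maximalCompact_le_carrier k)) j =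
      ∑ i : Fin 2, ((starRingEnd ℂ) (((k : GL (Fin 2 ⊕ Fin 1) ℂ) : Matrix (Fin 2 ⊕ Fin 1) (Fin 2 ⊕ Fin 1) ℂ) (Sum.inr 0) (Sum.inr 0)) *
        ((k : GL (Fin 2 ⊕ Fin 1) ℂ) : Matrix (Fin 2 ⊕ Fin 1) (Fin 2 ⊕ Fin 1) ℂ) (Sum.inl i) (Sum.inl j)) * Φ x i := by
  obtain ⟨κ, hκ, hA, hd⟩ := exists_blockU_eq k
  obtain ⟨hW, -, -, -⟩ := mem_holCotForms_iff.1 hΦ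
  rw [cmArchSectionUForm_apply, hκ]
  have h := WeightForms.right_equiv hW (blockK κ) x
  have e1 : ((cmArchSection L ι H T hT).comp (stabilizer (↥U21) x₀).subtype) (blockK κ) =
      cmArchSection L ι H T hT (blockU κ) := rfl
  rw [e1] at h
  rw [h, isPullbackCocycle_cotangentCocycle.weightOf_inv_apply, coe_blockK, cotangentCocycle_apply, Jac_blockU_x₀]
  simp only [Matrix.mulVec, dotProduct, Matrix.transpose_apply, Matrix.smul_apply, smul_eq_mul]
  refine Finset.sum_congr rfl fun i _ => ?_
  rw [hd, hA]
  rfl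

end Compact

/-! ## §3 Matrix-entry bookkeeping in `𝔲(2,1)_{Fin 2 ⊕ Fin 1}` for the value map -/

section Entries

/-- The inverse of `k ∈ K` is its conjugate transpose (as matrices). [cite: BorelWallach2000, VI 4.7] -/
theorem coe_inv_K (k : (uFormGroup (Fin 2) (Fin 1)).maximalCompact) :
    (((k : GL (Fin 2 ⊕ Fin 1) ℂ)⁻¹ : GL (Fin 2 ⊕ Fin 1) ℂ) : Matrix (Fin 2 ⊕ Fin 1) (Fin 2 ⊕ Fin 1) ℂ) =
      (((k : GL (Fin 2 ⊕ Fin 1) ℂ)) : Matrix (Fin 2 ⊕ Fin 1) (Fin 2 ⊕ Fin 1) ℂ)ᴴ := by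
  have hk := (RealMatrixGroup.mem_maximalCompact_iff (uFormGroup (Fin 2) (Fin 1)) (k : GL (Fin 2 ⊕ Fin 1) ℂ)).1 k.2
  have hunit : (((k : GL (Fin 2 ⊕ Fin 1) ℂ)) : Matrix (Fin 2 ⊕ Fin 1) (Fin 2 ⊕ Fin 1) ℂ)ᴴ *
      ((k : GL (Fin 2 ⊕ Fin 1) ℂ) : Matrix (Fin 2 ⊕ Fin 1) (Fin 2 ⊕ Fin 1) ℂ) = 1 := by
    rw [← Matrix.star_eq_conjTranspose]; exact hk.2
  rw [Matrix.coe_units_inv, Matrix.inv_eq_left_inv hunit]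

/-- **The `𝔭`-entries of `Ad(k) Y` for `k ∈ K`**: `(k Y k⁻¹)_{(inl i)(inr 0)} = ∑ j conj(k₂₂) kᵢⱼ Y_{(inl j)(inr 0)}` (block
diagonality of `k`; `K` acts on `𝔭 ≅ ℂ²` through `b ↦ d̄ A b`, the representation `τ₁` of Borel–Wallach VI 4.8 (3)).
[cite: BorelWallach2000, VI 4.8 (3)] -/
theorem Ad_K_apply_inl_inr (k : (uFormGroup (Fin 2) (Fin 1)).maximalCompact) (Y : (uFormGroup (Fin 2) (Fin 1)).lie)
    (i : Fin 2) :
    (((uFormGroup (Fin 2) (Fin 1)).Ad (Subgroup.inclusion (uFormGroup (Fin 2) (Fin 1)).maximalCompact_le_carrier k) Y :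
        (uFormGroup (Fin 2) (Fin 1)).lie) : Matrix (Fin 2 ⊕ Fin 1) (Fin 2 ⊕ Fin 1) ℂ) (Sum.inl i) (Sum.inr 0) =
      ∑ j : Fin 2, ((starRingEnd ℂ) (((k : GL (Fin 2 ⊕ Fin 1) ℂ) : Matrix (Fin 2 ⊕ Fin 1) (Fin 2 ⊕ Fin 1) ℂ) (Sum.inr 0) (Sum.inr 0)) *
        ((k : GL (Fin 2 ⊕ Fin 1) ℂ) : Matrix (Fin 2 ⊕ Fin 1) (Fin 2 ⊕ Fin 1) ℂ) (Sum.inl i) (Sum.inl j)) *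
        (Y : Matrix (Fin 2 ⊕ Fin 1) (Fin 2 ⊕ Fin 1) ℂ) (Sum.inl j) (Sum.inr 0) := by
  obtain ⟨h12, h21, -, -, -, -⟩ := upq_K_blocks k
  set kM : Matrix (Fin 2 ⊕ Fin 1) (Fin 2 ⊕ Fin 1) ℂ := ((k : GL (Fin 2 ⊕ Fin 1) ℂ) : Matrix (Fin 2 ⊕ Fin 1) (Fin 2 ⊕ Fin 1) ℂ) with hkM
  have hk12 : ∀ (a : Fin 2) (b : Fin 1), kM (Sum.inl a) (Sum.inr b) = 0 := fun a b => congrFun (congrFun h12 a) b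
  have hk21 : ∀ (a : Fin 1) (b : Fin 2), kM (Sum.inr a) (Sum.inl b) = 0 := fun a b => congrFun (congrFun h21 a) b
  have hginv : ((((Subgroup.inclusion (uFormGroup (Fin 2) (Fin 1)).maximalCompact_le_carrier k :
      (uFormGroup (Fin 2) (Fin 1)).carrier) : GL (Fin 2 ⊕ Fin 1) ℂ)⁻¹ : GL (Fin 2 ⊕ Fin 1) ℂ) :
        Matrix (Fin 2 ⊕ Fin 1) (Fin 2 ⊕ Fin 1) ℂ) = kMᴴ := coe_inv_K k
  rw [RealMatrixGroup.Ad_apply_coe, hginv]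
  change (kM * (Y : Matrix (Fin 2 ⊕ Fin 1) (Fin 2 ⊕ Fin 1) ℂ) * kMᴴ) (Sum.inl i) (Sum.inr 0) = _
  have hY0 : (kM * (Y : Matrix (Fin 2 ⊕ Fin 1) (Fin 2 ⊕ Fin 1) ℂ)) (Sum.inl i) (Sum.inr 0) =
      ∑ j : Fin 2, kM (Sum.inl i) (Sum.inl j) * (Y : Matrix (Fin 2 ⊕ Fin 1) (Fin 2 ⊕ Fin 1) ℂ) (Sum.inl j) (Sum.inr 0) := by
    rw [Matrix.mul_apply, Fintype.sum_sum_type, Fin.sum_univ_one, hk12, zero_mul, add_zero]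
  have hz : ∑ b : Fin 2, (kM * (Y : Matrix (Fin 2 ⊕ Fin 1) (Fin 2 ⊕ Fin 1) ℂ)) (Sum.inl i) (Sum.inl b) *
      kMᴴ (Sum.inl b) (Sum.inr 0) = 0 := by
    refine Finset.sum_eq_zero fun b _ => ?_
    rw [Matrix.conjTranspose_apply, hk21, star_zero, mul_zero]
  rw [Matrix.mul_apply, Fintype.sum_sum_type, Fin.sum_univ_one, hz, zero_add, Matrix.conjTranspose_apply, hY0,
    Finset.sum_mul]
  refine Finset.sum_congr rfl fun j _ => ?_
  rw [Complex.star_def]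
  ring

/-- **The `𝔭`-entries of `⁅z₀, Y⁆`**: `(⁅z₀, Y⁆)_{(inl i)(inr 0)} = i · Y_{(inl i)(inr 0)}` (`ad z₀` is multiplication by `i`
on `𝔭`, ★ `toBlocks₁₂_lie_upqZ0`). [cite: BorelWallach2000, II §4.1] -/
theorem lie_upqZ0_apply_inl_inr (Y : (uFormGroup (Fin 2) (Fin 1)).lie) (i : Fin 2) :
    ((⁅upqZ0 (Fin 2) (Fin 1), Y⁆ : (uFormGroup (Fin 2) (Fin 1)).lie) : Matrix (Fin 2 ⊕ Fin 1) (Fin 2 ⊕ Fin 1) ℂ)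
        (Sum.inl i) (Sum.inr 0) =
      Complex.I * (Y : Matrix (Fin 2 ⊕ Fin 1) (Fin 2 ⊕ Fin 1) ℂ) (Sum.inl i) (Sum.inr 0) := by
  have h := congrFun (congrFun (toBlocks₁₂_lie_upqZ0 Y) i) (0 : Fin 1)
  simpa [Matrix.toBlocks₁₂] using h

/-- **The `𝔭`-entries of `W ∈ 𝔨` vanish** (★ `upq_mem_kInLie_iff_blocks`). [cite: BorelWallach2000, II §4.1] -/
theorem apply_inl_inr_of_mem_kInLie {W : (uFormGroup (Fin 2) (Fin 1)).lie}
    (hW : W ∈ (uFormGroup (Fin 2) (Fin 1)).kInLie) (i : Fin 2) :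
    (W : Matrix (Fin 2 ⊕ Fin 1) (Fin 2 ⊕ Fin 1) ℂ) (Sum.inl i) (Sum.inr 0) = 0 := by
  have h := congrFun (congrFun ((upq_mem_kInLie_iff_blocks W).1 hW) i) (0 : Fin 1)
  simpa [Matrix.toBlocks₁₂] using h

/-- The `𝔭`-entries of the frame element `X_{cE_p}`: `(X_{cE_p})_{(inl i)(inr 0)} = c` if `i = p.1`, else `0`.
[cite: BorelWallach2000, VI 4.8 (3)] -/
theorem upqUnit_apply_inl_inr (p : Fin 2 × Fin 1) (c : ℂ) (i : Fin 2) :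
    ((upqUnit p c : (uFormGroup (Fin 2) (Fin 1)).lie) : Matrix (Fin 2 ⊕ Fin 1) (Fin 2 ⊕ Fin 1) ℂ) (Sum.inl i) (Sum.inr 0) =
      if i = p.1 then c else 0 := by
  rw [prod_fin_one_eq p, coe_upqUnit, Matrix.fromBlocks_apply₁₂, Matrix.single_apply]
  by_cases hi : i = p.1
  · simp [hi]
  · simp [hi, Ne.symm hi]

end Entries

end Summit.HodgeConjecture.HodgeConjecture.Cruxes.H413.F0P3CMFrameOrbit

end
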